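import Literature.Computability.AlgebraicComplexity.ValiantReductionCellsII
import HarnessLib

/-!
# Valiant's reduction as a polynomial-time machine, III: the flat integer entry `mz`

Third machine file. `Valiant3CNF.mz ψ x y` (the integer entry of Valiant's matrix at flat indices
`x, y < 34m`, `Valiant3CNFFlat.lean`) as an `FP` brick `ValiantFP.mzF` on `⟨⌜ψ⌝, ⟨1ˣ, 1ʸ⟩⟩`, with
value `cls (mz ψ x y)` (`mzF_encode`). The brick follows the case structure of `mz` (regions
`x < 7m` / `7m ≤ x < 31m` / `31m ≤ x` for rows and columns; inside the middle region the offset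
`x - 7m` is read as `8 o + e`), branching with `iteB` on unary comparisons, and calls the pieces of
parts I–II (`ent0F`, `colRF`, `vtabF`, `isFirstF`, `isLastF`, `isNextF`, `varEqF`, `dposB`).

## References

* L. G. Valiant, *The complexity of computing the permanent*, Theoret. Comput. Sci. 8 (1979)
  189–201, Lemma 3.1, Thm. 1.
* S. Arora, B. Barak, *Computational Complexity: A Modern Approach*, CUP 2009, §1.3.
-/

noncomputable section

namespace Literature.Computability.AlgebraicComplexity

open _root_.Computability Literature.Computability.Complexity Brick HashBricks Plumb OracleCompose Polynomial
open Valiant3CNF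

namespace ValiantFP

variable (ψ : CNF ℕ)

/-! ### Fields of `⟨x₀, ⟨1ˣ, 1ʸ⟩⟩` -/

/-- `1ᵐ` (the clause count, the header of `x₀ = ⌜ψ⌝`). [folklore] -/
def gM : List Bool → List Bool := fstF ∘ fstF
/-- `1^{7m}`. [folklore] -/
def g7 : List Bool → List Bool := mulB 7 gM
/-- `1^{31m}`. [folklore] -/
def g31 : List Bool → List Bool := mulB 31 gM
/-- `1^{x - 7m}`. [folklore] -/
def gXD : List Bool → List Bool := subB fR g7
/-- `1^{y - 7m}`. [folklore] -/
def gYD : List Bool → List Bool := subB fS g7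
/-- `1^{(x - 7m)/8}` (the occurrence of a middle row). [folklore] -/
def gOX : List Bool → List Bool := quoB 8 gXD
/-- `1^{(x - 7m) mod 8}`. [folklore] -/
def gEX : List Bool → List Bool := remB 8 gXD
/-- `1^{(y - 7m)/8}`. [folklore] -/
def gOY : List Bool → List Bool := quoB 8 gYD
/-- `1^{(y - 7m) mod 8}`. [folklore] -/
def gEY : List Bool → List Bool := remB 8 gYD
/-- `1^{(x - 7m) mod 8 - 4}`. [folklore] -/
def gEX4 : List Bool → List Bool := subB gEX (cst (ones 4))
/-- `1^{(y - 7m) mod 8 - 4}`. [folklore] -/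
def gEY4 : List Bool → List Bool := subB gEY (cst (ones 4))
/-- `1^{x - 31m}` (the control slot of a bottom row). [folklore] -/
def gCX : List Bool → List Bool := subB fR g31
/-- `1^{y - 31m}`. [folklore] -/
def gCY : List Bool → List Bool := subB fS g31

/-- `[colR ψ x o_y = 1]`. [folklore] -/
def hCol : List Bool → List Bool := colRF ∘ fanoutFn fstF (fanoutFn fR gOY)
/-- `[isNext3 ψ o_x o_y]`. [folklore] -/
def hNext : List Bool → List Bool := isNextF ∘ fanoutFn fstF (fanoutFn gOX gOY)
/-- `[isLast3 ψ (3m) o_x]`. [folklore] -/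
def hLast : List Bool → List Bool := isLastF ∘ fanoutFn fstF gOX
/-- `[isFirst3 ψ c_y]`. [folklore] -/
def hFirstY : List Bool → List Bool := isFirstF ∘ fanoutFn fstF gCY
/-- `[isFirst3 ψ c_x]`. [folklore] -/
def hFirstX : List Bool → List Bool := isFirstF ∘ fanoutFn fstF gCX
/-- `[var? c_y = var? o_x]`. [folklore] -/
def hVarEq : List Bool → List Bool := varEqF ∘ fanoutFn fstF (fanoutFn gCY gOX)

/-! ### The brick -/

/-- Rows `x < 7m` (original nodes). [cite: Valiant1979, Lemma 3.1] -/
def mzTop : List Bool → List Bool :=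
  iteB (ltB fS g7) ent0F
    (iteB (ltB fS g31)
      (iteB (ltB gEY (cst (ones 4))) (cst (cls 0))
        (iteB (eqB gEY4 (cst (ones 3))) (iteB hCol (cst (cls 1)) (cst (cls 0))) (cst (cls 0))))
      (cst (cls 0)))

/-- Rows `7m ≤ x < 31m` with `e < 4` (the `L`-nodes of an occurrence). [cite: Valiant1979, Lemma 3.1] -/
def mzMidL : List Bool → List Bool :=
  iteB (ltB fS g7) (cst (cls 0))
    (iteB (ltB fS g31)
      (iteB (ltB gEY (cst (ones 4)))
        (iteB (eqB gOX gOY) (vtabF gEX gEY)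
          (iteB (andB (eqB gEX (cst [])) (andB (eqB gEY (cst (ones 3))) hNext)) (cst (cls 1)) (cst (cls 0))))
        (iteB (andB (eqB gOX gOY) (andB (eqB gEX (cst (ones 3))) (eqB gEY4 (cst [])))) (cst (cls 1)) (cst (cls 0))))
      (iteB (andB (eqB gEX (cst [])) (andB hLast (andB hFirstY hVarEq))) (cst (cls 1)) (cst (cls 0))))

/-- Rows `7m ≤ x < 31m` with `4 ≤ e` (the `R`-nodes of an occurrence). [cite: Valiant1979, Lemma 3.1] -/
def mzMidR : List Bool → List Bool :=
  iteB (ltB fS g7)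
    (iteB (andB (eqB gEX4 (cst [])) (eqB fS (dposB gOX))) (cst (cls 1)) (cst (cls 0)))
    (iteB (ltB fS g31)
      (iteB (ltB gEY (cst (ones 4)))
        (iteB (andB (eqB gOX gOY) (andB (eqB gEX4 (cst (ones 3))) (eqB gEY (cst [])))) (cst (cls 1)) (cst (cls 0)))
        (iteB (eqB gOX gOY) (vtabF gEX4 gEY4) (cst (cls 0))))
      (cst (cls 0)))

/-- Rows `31m ≤ x` (control slots). [cite: Valiant1979, Lemma 3.1] -/
def mzBot : List Bool → List Bool :=
  iteB (ltB fS g7) (cst (cls 0))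
    (iteB (ltB fS g31)
      (iteB (ltB gEY (cst (ones 4)))
        (iteB (andB hFirstX (andB (eqB gOY gCX) (eqB gEY (cst (ones 3))))) (cst (cls 1)) (cst (cls 0)))
        (cst (cls 0)))
      (iteB (eqB gCX gCY) (cst (cls 1)) (cst (cls 0))))

/-- **The flat integer entry `mz ψ x y` as a brick** on `⟨⌜ψ⌝, ⟨1ˣ, 1ʸ⟩⟩`, value `cls (mz ψ x y)`. [cite: Valiant1979, Lemma 3.1] -/
def mzF : List Bool → List Bool :=
  iteB (ltB fR g7) mzTop (iteB (ltB fR g31) (iteB (ltB gEX (cst (ones 4))) mzMidL mzMidR) mzBot)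

/-! ### `FP` membership -/

/-- `gM ∈ FP`. [folklore] -/
theorem gM_mem_FP : gM ∈ FP := comp_mem_FP fstF_mem_FP fstF_mem_FP
/-- `fR ∈ FP`. [folklore] -/
theorem fR_mem_FP : fR ∈ FP := comp_mem_FP fstF_mem_FP sndF_mem_FP
/-- `fS ∈ FP`. [folklore] -/
theorem fS_mem_FP : fS ∈ FP := comp_mem_FP sndF_mem_FP sndF_mem_FP
/-- `g7 ∈ FP`. [folklore] -/
theorem g7_mem_FP : g7 ∈ FP := mulB_mem_FP 7 gM_mem_FP
/-- `g31 ∈ FP`. [folklore] -/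
theorem g31_mem_FP : g31 ∈ FP := mulB_mem_FP 31 gM_mem_FP
/-- `gXD ∈ FP`. [folklore] -/
theorem gXD_mem_FP : gXD ∈ FP := subB_mem_FP fR_mem_FP g7_mem_FP
/-- `gYD ∈ FP`. [folklore] -/
theorem gYD_mem_FP : gYD ∈ FP := subB_mem_FP fS_mem_FP g7_mem_FP
/-- `gOX ∈ FP`. [folklore] -/
theorem gOX_mem_FP : gOX ∈ FP := quoB_mem_FP 8 gXD_mem_FP
/-- `gEX ∈ FP`. [folklore] -/
theorem gEX_mem_FP : gEX ∈ FP := remB_mem_FP 8 gXD_mem_FP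
/-- `gOY ∈ FP`. [folklore] -/
theorem gOY_mem_FP : gOY ∈ FP := quoB_mem_FP 8 gYD_mem_FP
/-- `gEY ∈ FP`. [folklore] -/
theorem gEY_mem_FP : gEY ∈ FP := remB_mem_FP 8 gYD_mem_FP
/-- `gEX4 ∈ FP`. [folklore] -/
theorem gEX4_mem_FP : gEX4 ∈ FP := subB_mem_FP gEX_mem_FP (cst_mem_FP _)
/-- `gEY4 ∈ FP`. [folklore] -/
theorem gEY4_mem_FP : gEY4 ∈ FP := subB_mem_FP gEY_mem_FP (cst_mem_FP _)
/-- `gCX ∈ FP`. [folklore] -/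
theorem gCX_mem_FP : gCX ∈ FP := subB_mem_FP fR_mem_FP g31_mem_FP
/-- `gCY ∈ FP`. [folklore] -/
theorem gCY_mem_FP : gCY ∈ FP := subB_mem_FP fS_mem_FP g31_mem_FP
/-- `hCol ∈ FP`. [folklore] -/
theorem hCol_mem_FP : hCol ∈ FP := comp_mem_FP colRF_mem_FP (fanoutFn_mem_FP fstF_mem_FP (fanoutFn_mem_FP fR_mem_FP gOY_mem_FP))
/-- `hNext ∈ FP`. [folklore] -/
theorem hNext_mem_FP : hNext ∈ FP := comp_mem_FP isNextF_mem_FP (fanoutFn_mem_FP fstF_mem_FP (fanoutFn_mem_FP gOX_mem_FP gOY_mem_FP))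
/-- `hLast ∈ FP`. [folklore] -/
theorem hLast_mem_FP : hLast ∈ FP := comp_mem_FP isLastF_mem_FP (fanoutFn_mem_FP fstF_mem_FP gOX_mem_FP)
/-- `hFirstY ∈ FP`. [folklore] -/
theorem hFirstY_mem_FP : hFirstY ∈ FP := comp_mem_FP isFirstF_mem_FP (fanoutFn_mem_FP fstF_mem_FP gCY_mem_FP)
/-- `hFirstX ∈ FP`. [folklore] -/
theorem hFirstX_mem_FP : hFirstX ∈ FP := comp_mem_FP isFirstF_mem_FP (fanoutFn_mem_FP fstF_mem_FP gCX_mem_FP)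
/-- `hVarEq ∈ FP`. [folklore] -/
theorem hVarEq_mem_FP : hVarEq ∈ FP := comp_mem_FP varEqF_mem_FP (fanoutFn_mem_FP fstF_mem_FP (fanoutFn_mem_FP gCY_mem_FP gOX_mem_FP))

/-- `mzTop ∈ FP`. [folklore] -/
theorem mzTop_mem_FP : mzTop ∈ FP :=
  iteB_mem_FP (ltB_mem_FP fS_mem_FP g7_mem_FP) ent0F_mem_FP
    (iteB_mem_FP (ltB_mem_FP fS_mem_FP g31_mem_FP)
      (iteB_mem_FP (ltB_mem_FP gEY_mem_FP (cst_mem_FP _)) (cst_mem_FP _)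
        (iteB_mem_FP (eqB_mem_FP gEY4_mem_FP (cst_mem_FP _)) (iteB_mem_FP hCol_mem_FP (cst_mem_FP _) (cst_mem_FP _)) (cst_mem_FP _)))
      (cst_mem_FP _))

/-- `mzMidL ∈ FP`. [folklore] -/
theorem mzMidL_mem_FP : mzMidL ∈ FP :=
  iteB_mem_FP (ltB_mem_FP fS_mem_FP g7_mem_FP) (cst_mem_FP _)
    (iteB_mem_FP (ltB_mem_FP fS_mem_FP g31_mem_FP)
      (iteB_mem_FP (ltB_mem_FP gEY_mem_FP (cst_mem_FP _))
        (iteB_mem_FP (eqB_mem_FP gOX_mem_FP gOY_mem_FP) (vtabF_mem_FP gEX_mem_FP gEY_mem_FP)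
          (iteB_mem_FP (andB_mem_FP (eqB_mem_FP gEX_mem_FP (cst_mem_FP _)) (andB_mem_FP (eqB_mem_FP gEY_mem_FP (cst_mem_FP _)) hNext_mem_FP))
            (cst_mem_FP _) (cst_mem_FP _)))
        (iteB_mem_FP (andB_mem_FP (eqB_mem_FP gOX_mem_FP gOY_mem_FP) (andB_mem_FP (eqB_mem_FP gEX_mem_FP (cst_mem_FP _)) (eqB_mem_FP gEY4_mem_FP (cst_mem_FP _))))
          (cst_mem_FP _) (cst_mem_FP _)))
      (iteB_mem_FP (andB_mem_FP (eqB_mem_FP gEX_mem_FP (cst_mem_FP _)) (andB_mem_FP hLast_mem_FP (andB_mem_FP hFirstY_mem_FP hVarEq_mem_FP)))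
        (cst_mem_FP _) (cst_mem_FP _)))

/-- `mzMidR ∈ FP`. [folklore] -/
theorem mzMidR_mem_FP : mzMidR ∈ FP :=
  iteB_mem_FP (ltB_mem_FP fS_mem_FP g7_mem_FP)
    (iteB_mem_FP (andB_mem_FP (eqB_mem_FP gEX4_mem_FP (cst_mem_FP _)) (eqB_mem_FP fS_mem_FP (dposB_mem_FP gOX_mem_FP))) (cst_mem_FP _) (cst_mem_FP _))
    (iteB_mem_FP (ltB_mem_FP fS_mem_FP g31_mem_FP)
      (iteB_mem_FP (ltB_mem_FP gEY_mem_FP (cst_mem_FP _))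
        (iteB_mem_FP (andB_mem_FP (eqB_mem_FP gOX_mem_FP gOY_mem_FP) (andB_mem_FP (eqB_mem_FP gEX4_mem_FP (cst_mem_FP _)) (eqB_mem_FP gEY_mem_FP (cst_mem_FP _))))
          (cst_mem_FP _) (cst_mem_FP _))
        (iteB_mem_FP (eqB_mem_FP gOX_mem_FP gOY_mem_FP) (vtabF_mem_FP gEX4_mem_FP gEY4_mem_FP) (cst_mem_FP _)))
      (cst_mem_FP _))

/-- `mzBot ∈ FP`. [folklore] -/
theorem mzBot_mem_FP : mzBot ∈ FP :=
  iteB_mem_FP (ltB_mem_FP fS_mem_FP g7_mem_FP) (cst_mem_FP _)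
    (iteB_mem_FP (ltB_mem_FP fS_mem_FP g31_mem_FP)
      (iteB_mem_FP (ltB_mem_FP gEY_mem_FP (cst_mem_FP _))
        (iteB_mem_FP (andB_mem_FP hFirstX_mem_FP (andB_mem_FP (eqB_mem_FP gOY_mem_FP gCX_mem_FP) (eqB_mem_FP gEY_mem_FP (cst_mem_FP _))))
          (cst_mem_FP _) (cst_mem_FP _))
        (cst_mem_FP _))
      (iteB_mem_FP (eqB_mem_FP gCX_mem_FP gCY_mem_FP) (cst_mem_FP _) (cst_mem_FP _)))

/-- **`mzF ∈ FP`.** [cite: Valiant1979, Thm. 1] -/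
theorem mzF_mem_FP : mzF ∈ FP :=
  iteB_mem_FP (ltB_mem_FP fR_mem_FP g7_mem_FP) mzTop_mem_FP
    (iteB_mem_FP (ltB_mem_FP fR_mem_FP g31_mem_FP)
      (iteB_mem_FP (ltB_mem_FP gEX_mem_FP (cst_mem_FP _)) mzMidL_mem_FP mzMidR_mem_FP) mzBot_mem_FP)

/-! ### Values of the fields -/

section Values

variable (x₀ : List Bool) (x y : ℕ)

local notation "uu" => boolPair x₀ (boolPair (ones x) (ones y))
set_option quotPrecheck false in
local notation "n" => (fstF x₀).length

/-- Value of `fR`. [folklore] -/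
theorem fR_val : fR uu = ones x := by simp [fR]
/-- Value of `fS`. [folklore] -/
theorem fS_val : fS uu = ones y := by simp [fS]
/-- Value of `gM`. [folklore] -/
theorem gM_val : gM uu = fstF x₀ := by simp [gM]
/-- Value of `g7`. [folklore] -/
theorem g7_val : g7 uu = ones (7 * n) := by rw [g7, mulB_apply, gM_val]
/-- Value of `g31`. [folklore] -/
theorem g31_val : g31 uu = ones (31 * n) := by rw [g31, mulB_apply, gM_val]
/-- Value of `gXD`. [folklore] -/
theorem gXD_val : gXD uu = ones (x - 7 * n) := by rw [gXD, subB_apply, fR_val, g7_val, length_ones, ones_drop]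
/-- Value of `gYD`. [folklore] -/
theorem gYD_val : gYD uu = ones (y - 7 * n) := by rw [gYD, subB_apply, fS_val, g7_val, length_ones, ones_drop]
/-- Value of `gOX`. [folklore] -/
theorem gOX_val : gOX uu = ones ((x - 7 * n) / 8) := by unfold gOX; exact quoB_apply 8 _ _ _ (gXD_val x₀ x y)
/-- Value of `gEX`. [folklore] -/
theorem gEX_val : gEX uu = ones ((x - 7 * n) % 8) := by unfold gEX; exact remB_apply 8 _ _ _ (gXD_val x₀ x y)
/-- Value of `gOY`. [folklore] -/
theorem gOY_val : gOY uu = ones ((y - 7 * n) / 8) := by unfold gOY; exact quoB_apply 8 _ _ _ (gYD_val x₀ x y)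
/-- Value of `gEY`. [folklore] -/
theorem gEY_val : gEY uu = ones ((y - 7 * n) % 8) := by unfold gEY; exact remB_apply 8 _ _ _ (gYD_val x₀ x y)
/-- Value of `gEX4`. [folklore] -/
theorem gEX4_val : gEX4 uu = ones ((x - 7 * n) % 8 - 4) := by
  rw [gEX4, subB_apply, gEX_val, cst_apply, length_ones, ones_drop]
/-- Value of `gEY4`. [folklore] -/
theorem gEY4_val : gEY4 uu = ones ((y - 7 * n) % 8 - 4) := by
  rw [gEY4, subB_apply, gEY_val, cst_apply, length_ones, ones_drop]
/-- Value of `gCX`. [folklore] -/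
theorem gCX_val : gCX uu = ones (x - 31 * n) := by rw [gCX, subB_apply, fR_val, g31_val, length_ones, ones_drop]
/-- Value of `gCY`. [folklore] -/
theorem gCY_val : gCY uu = ones (y - 31 * n) := by rw [gCY, subB_apply, fS_val, g31_val, length_ones, ones_drop]
/-- Value of `dposB_gOX`. [folklore] -/
theorem dposB_gOX_val : dposB gOX uu = ones (dpos ((x - 7 * n) / 8)) := dposB_apply _ _ _ (gOX_val x₀ x y)
/-- Value of `vtabL`. [folklore] -/
theorem vtabL_val : vtabF gEX gEY uu = cls (vtab ((x - 7 * n) % 8) ((y - 7 * n) % 8)) :=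
  vtabF_apply _ _ _ _ _ (gEX_val x₀ x y) (gEY_val x₀ x y)
/-- Value of `vtabR`. [folklore] -/
theorem vtabR_val : vtabF gEX4 gEY4 uu = cls (vtab ((x - 7 * n) % 8 - 4) ((y - 7 * n) % 8 - 4)) :=
  vtabF_apply _ _ _ _ _ (gEX4_val x₀ x y) (gEY4_val x₀ x y)
/-- The argument record passed on by `hCol`. [folklore] -/
theorem hCol_arg : hCol uu = colRF (boolPair x₀ (boolPair (ones x) (ones ((y - 7 * n) / 8)))) := by
  rw [hCol, Function.comp_apply, fanoutFn_apply, fanoutFn_apply, fstF_boolPair, fR_val, gOY_val]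
/-- The argument record passed on by `hNext`. [folklore] -/
theorem hNext_arg : hNext uu = isNextF (boolPair x₀ (boolPair (ones ((x - 7 * n) / 8)) (ones ((y - 7 * n) / 8)))) := by
  rw [hNext, Function.comp_apply, fanoutFn_apply, fanoutFn_apply, fstF_boolPair, gOX_val, gOY_val]
/-- The argument record passed on by `hLast`. [folklore] -/
theorem hLast_arg : hLast uu = isLastF (boolPair x₀ (ones ((x - 7 * n) / 8))) := by
  rw [hLast, Function.comp_apply, fanoutFn_apply, fstF_boolPair, gOX_val]
/-- The argument record passed on by `hFirstY`. [folklore] -/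
theorem hFirstY_arg : hFirstY uu = isFirstF (boolPair x₀ (ones (y - 31 * n))) := by
  rw [hFirstY, Function.comp_apply, fanoutFn_apply, fstF_boolPair, gCY_val]
/-- The argument record passed on by `hFirstX`. [folklore] -/
theorem hFirstX_arg : hFirstX uu = isFirstF (boolPair x₀ (ones (x - 31 * n))) := by
  rw [hFirstX, Function.comp_apply, fanoutFn_apply, fstF_boolPair, gCX_val]
/-- The argument record passed on by `hVarEq`. [folklore] -/
theorem hVarEq_arg : hVarEq uu = varEqF (boolPair x₀ (boolPair (ones (y - 31 * n)) (ones ((x - 7 * n) / 8)))) := by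
  rw [hVarEq, Function.comp_apply, fanoutFn_apply, fanoutFn_apply, fstF_boolPair, gCY_val, gOX_val]

end Values

/-- The header length of the code of `ψ` is `m`. [folklore] -/
theorem length_fstF_encode : (fstF (encodingCNF.encode ψ)).length = ψ.length := by
  rw [encode_eq, fstF_boolPair, length_ones]

/-! ### Value, region by region -/

section Regions

variable {ψ} (hw : CNF.IsWidthEq 3 ψ) (x y : ℕ)

local notation "uψ" => boolPair (encodingCNF.encode ψ) (boolPair (ones x) (ones y))

include hw in
/-- Top rows. [cite: Valiant1979, Lemma 3.1] -/
theorem mzTop_encode (hx7 : x < 7 * ψ.length) : mzTop uψ = cls (mz ψ x y) := by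
  have hn := length_fstF_encode ψ
  by_cases hy7 : y < 7 * ψ.length
  · have vE := ent0F_encode ψ hw x y hy7
    simp only [mzTop, iteB_apply, ltB_apply, fS_val, g7_val, hn, length_ones, hy7, decide_true, List.headD_cons,
      if_true, vE, mz, hx7]
  by_cases hy31 : y < 31 * ψ.length
  · have hoy : (y - 7 * ψ.length) / 8 < 3 * ψ.length := by omega
    have vC : hCol uψ = [decide (colR ψ x ((y - 7 * ψ.length) / 8) = 1)] := by
      rw [hCol_arg, hn]; exact colRF_encode ψ hw x ⟨_, hoy⟩
    have hc01 := colR_mem ψ x ((y - 7 * ψ.length) / 8)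
    simp only [mzTop, iteB_apply, ltB_apply, eqB_apply, fS_val, g7_val, g31_val, gEY_val, gEY4_val, hn, vC, cst_apply,
      length_ones, ones_inj, hx7, hy7, hy31, decide_true, decide_false, List.headD_cons, if_true, if_false,
      Bool.false_eq_true, mz, decide_eq_true_eq, cls_ite]
    split_ifs <;> first | rfl | (rcases hc01 with h | h <;> simp_all)
  · simp only [mzTop, iteB_apply, ltB_apply, fS_val, g7_val, g31_val, hn, cst_apply, length_ones, hx7, hy7, hy31,
      decide_false, List.headD_cons, if_true, if_false, Bool.false_eq_true, mz]

include hw in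
/-- Middle rows, `L`-nodes. [cite: Valiant1979, Lemma 3.1] -/
theorem mzMidL_encode (hy : y < 34 * ψ.length) (hx7 : ¬ x < 7 * ψ.length) (hx31 : x < 31 * ψ.length)
    (he : (x - 7 * ψ.length) % 8 < 4) : mzMidL uψ = cls (mz ψ x y) := by
  have hn := length_fstF_encode ψ
  have hox : (x - 7 * ψ.length) / 8 < 3 * ψ.length := by omega
  have hcy : y - 31 * ψ.length < 3 * ψ.length := by omega
  have vL : hLast uψ = [decide (isLast3 ψ (3 * ψ.length) ((x - 7 * ψ.length) / 8))] := by
    rw [hLast_arg, hn]; exact isLastF_encode ψ hw ⟨_, hox⟩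
  have vV : hVarEq uψ = [decide (var? ψ (y - 31 * ψ.length) = var? ψ ((x - 7 * ψ.length) / 8))] := by
    rw [hVarEq_arg, hn]; exact varEqF_encode ψ hw ⟨_, hcy⟩ ⟨_, hox⟩
  have vFY : hFirstY uψ = [decide (isFirst3 ψ (y - 31 * ψ.length))] := by
    rw [hFirstY_arg, hn]; exact isFirstF_encode ψ hw ⟨_, hcy⟩
  by_cases hy31 : y < 31 * ψ.length
  · have hoy : (y - 7 * ψ.length) / 8 < 3 * ψ.length := by omega
    have vN : hNext uψ = [decide (isNext3 ψ ((x - 7 * ψ.length) / 8) ((y - 7 * ψ.length) / 8))] := by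
      rw [hNext_arg, hn]; exact isNextF_encode ψ hw ⟨_, hox⟩ ⟨_, hoy⟩
    simp only [mzMidL, iteB_apply, ltB_apply, eqB_apply, andB_apply, fS_val, g7_val, g31_val, gOX_val, gEX_val, gOY_val,
      gEY_val, gEY4_val, vtabL_val, hn, vN, cst_apply, length_ones, ones_inj, ones_eq_nil, hx7, hx31, hy31, he,
      decide_true, List.headD_cons, if_true, if_false, mz, decide_eq_true_eq, Bool.and_eq_true, cls_ite]
  · simp only [mzMidL, iteB_apply, ltB_apply, eqB_apply, andB_apply, fS_val, g7_val, g31_val, gEX_val, hn, vL, vV, vFY,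
      cst_apply, length_ones, ones_inj, ones_eq_nil, hx7, hx31, hy31, he, decide_false, List.headD_cons,
      if_true, if_false, Bool.false_eq_true, mz, decide_eq_true_eq, Bool.and_eq_true, cls_ite]

/-- Middle rows, `R`-nodes. [cite: Valiant1979, Lemma 3.1] -/
theorem mzMidR_encode (hx7 : ¬ x < 7 * ψ.length) (hx31 : x < 31 * ψ.length) (he : ¬ (x - 7 * ψ.length) % 8 < 4) :
    mzMidR uψ = cls (mz ψ x y) := by
  have hn := length_fstF_encode ψ
  simp only [mzMidR, iteB_apply, ltB_apply, eqB_apply, andB_apply, fS_val, g7_val, g31_val, gOX_val, gOY_val,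
    gEY_val, gEX4_val, vtabR_val, dposB_gOX_val, hn, cst_apply, length_ones, ones_inj, ones_eq_nil, hx7, hx31,
    he, List.headD_cons, if_true, if_false, mz, decide_eq_true_eq, Bool.and_eq_true, cls_ite]

include hw in
/-- Bottom rows. [cite: Valiant1979, Lemma 3.1] -/
theorem mzBot_encode (hx : x < 34 * ψ.length) (hx7 : ¬ x < 7 * ψ.length) (hx31 : ¬ x < 31 * ψ.length) :
    mzBot uψ = cls (mz ψ x y) := by
  have hn := length_fstF_encode ψ
  have hcx : x - 31 * ψ.length < 3 * ψ.length := by omega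
  have vFX : hFirstX uψ = [decide (isFirst3 ψ (x - 31 * ψ.length))] := by
    rw [hFirstX_arg, hn]; exact isFirstF_encode ψ hw ⟨_, hcx⟩
  simp only [mzBot, iteB_apply, ltB_apply, eqB_apply, andB_apply, fS_val, g7_val, g31_val, gOY_val, gEY_val, gCX_val,
    gCY_val, hn, vFX, cst_apply, length_ones, ones_inj, hx7, hx31, List.headD_cons,
    if_false, mz, decide_eq_true_eq, Bool.and_eq_true, cls_ite]

include hw in
/-- **`mzF` computes the class of `mz ψ x y`** for `x, y < 34m`. [cite: Valiant1979, Lemma 3.1] -/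
theorem mzF_encode (hx : x < 34 * ψ.length) (hy : y < 34 * ψ.length) : mzF uψ = cls (mz ψ x y) := by
  have hn := length_fstF_encode ψ
  by_cases hx7 : x < 7 * ψ.length
  · rw [← mzTop_encode hw x y hx7]
    simp only [mzF, iteB_apply, ltB_apply, fR_val, g7_val, hn, length_ones, hx7, decide_true, List.headD_cons, if_true]
  by_cases hx31 : x < 31 * ψ.length
  · by_cases he : (x - 7 * ψ.length) % 8 < 4
    · rw [← mzMidL_encode hw x y hy hx7 hx31 he]
      simp only [mzF, iteB_apply, ltB_apply, fR_val, g7_val, g31_val, gEX_val, hn, cst_apply, length_ones, hx7, hx31, he,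
        decide_true, decide_false, List.headD_cons, if_true, if_false, Bool.false_eq_true]
    · rw [← mzMidR_encode x y hx7 hx31 he]
      simp only [mzF, iteB_apply, ltB_apply, fR_val, g7_val, g31_val, gEX_val, hn, cst_apply, length_ones, hx7, hx31, he,
        decide_true, decide_false, List.headD_cons, if_true, if_false, Bool.false_eq_true]
  · rw [← mzBot_encode hw x y hx hx7 hx31]
    simp only [mzF, iteB_apply, ltB_apply, fR_val, g7_val, g31_val, hn, length_ones, hx7, hx31, decide_false,
      List.headD_cons, if_false, Bool.false_eq_true]

end Regions

end ValiantFP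

end Literature.Computability.AlgebraicComplexity
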